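import Summits.BirchSwinnertonDyer.Rank1Residual.Additive.MixedCongruenceTameness
import Literature.NumberTheory.EllipticCurves.Rank1Residual.X9NoEntry
import Mathlib.Tactic.Module
import HarnessLib

/-!
# Small (irreducible, non-surjective) mod-`p` image: NO unipotent Galois element on `E[p]`, and the
# image of every line-stabilising subgroup (e.g. an inertia group at an ordinary-type prime) is
# ABELIAN — part 1 of the O8-TAME kernel theorem
# (cell `b2b-bsdres`, lane CLASS-CLOSURE, seat cc-typer-1 = typer of record N11 / O8; prover task
# "O8-TAME" of `class-closure/O8/STATEMENT.md` §12; joint small-image axis O8 / N2 = X10b@3 /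
# N3 = X9@{5,7}; sequel `GaloisImage/SmallImageTameInertia.lean` draws `InertiaSplitAt`)

HONEST FRAMING (cell `b2b-bsdres`, run/shared/lean/b2b/bsd-rank1-residual/, verbatim in every
file): the goal of the cell is to DELETE the COMBINATION-SHAPED residual classes of the
Birch–Swinnerton-Dyer formula for ALL analytic-rank `≤ 1` elliptic curves over `ℚ` — "full BSD
formula for every rank `≤ 1` curve in class `C`" assembled STRICTLY from published theorems — so
that the rank-`≤ 1` remainder becomes exactly the CONSTRUCTION-SHAPED classes, which are TYPED
(missing-input `Prop`s), NOT attempted. This is not "finishing BSD". Lane CLASS-CLOSURE: research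
routes, no claim beyond the stated classes; census output = EVIDENCE, never a Literature fact;
NOTHING is booked here. This file contains THEOREMS ONLY (finite group theory of the image of
`ρ̄_{E,p}` and linear algebra on the `𝔽_p`-plane `E[p]`, over tree predicates); no definition, no
named fact, no conjecture, no `sorry`.

## What is proved

Write `ρ̄ = ρ̄_{E,p} : Γ_ℚ → Aut(E[p])`, `G = ρ̄(Γ_ℚ)`. On the small-image classes (O8 =
`ClassX4 W p ∧ ¬ Surj W p`; N2 = X10b = `ClassX10 W 3 ∧ ¬ Surj W 3`; N3 = X9 = `ClassX9 W p`) the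
image is IRREDUCIBLE and PROPER, and `det G = 𝔽_pˣ` over `ℚ`; Serre's Prop. 15 read backwards
(tree: `WeierstrassCurve.not_dvd_card_of_not_hasSurjectiveModNGaloisRep`) gives `p ∤ #G`.

* §0: elementary facts on lines (subgroups of order `p`) in `E[p]` (`#E[p] = p²`): invertible
  integer scalars, decomposition `E[p] = L + ℤ Q₀` for `Q₀ ∉ L`, "non-trivial and transverse to a
  line ⟹ a line", eigen-subgroups of a Galois element, and: a Galois element stabilising a line
  acts on it AND on the quotient by integer scalars (both are cyclic of order `p`).
* §1 `smul_eq_self_of_unipotent_of_irr_of_not_surj` — **no unipotent Galois element**: if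
  `τ ∈ Γ_ℚ` acts on `E[p]` unipotently (`τ (τ Q − Q) = τ Q − Q` for all `Q`) then `τ` acts
  trivially (`ρ̄(τ)` would have order `p`; `galoisRepTorsion_pow_prime_eq_one_of_unipotent`). The
  mod-`p` content of the cell's `not_bigIm_of_irr_of_not_surj` / `surj_of_irr_of_ram`, for an
  ARBITRARY `τ`; line-stabiliser form `smul_eq_self_of_fix_line_of_irr_of_not_surj`.
* §2 `smul_comm_of_stableLine_of_irr_of_not_surj` — **the image of any subgroup `I ≤ Γ_ℚ`
  stabilising a line `L ≤ E[p]` is ABELIAN**: `I` acts on `L` and on `E[p]/L` through scalars, so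
  a commutator `κ = τ τ' τ⁻¹ τ'⁻¹` fixes `L` pointwise and acts trivially on `E[p]/L` — it is
  unipotent, hence trivial by §1 (the image of `I` meets the unipotent radical of the Borel
  subgroup of `L` trivially, so it embeds in the torus `𝔽_pˣ × 𝔽_pˣ`).

READING: at an ordinary-type prime `p` (good ordinary, multiplicative, or additive potentially
ordinary / potentially multiplicative of inertial type `ω`) the inertia group `I_𝔓` stabilises a
line of `E[p]`; on the small-image classes its image is therefore abelian of order prime to `p` —
the input from which the sequel proves `InertiaSplitAt` (TAME, `ρ̄|_{I_p} ≅ χ ⊕ 1`). Nothing about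
BSD_p; O8 / N2 / N3 stay OPEN; nothing is booked.

References: J.-P. Serre, Invent. Math. 15 (1972) §2.4 Prop. 15 [Serre1972];
class-closure/O8/STATEMENT.md §12; class-closure/N11/SUBPARTITION-typed.md v1.2 (row TAME);
Summits `Additive/MixedCongruenceTameness.lean` (p258175).
-/

set_option autoImplicit false

noncomputable section

open scoped Classical

open WeierstrassCurve Literature.NumberTheory.EllipticCurves Literature.NumberTheory.GaloisRepresentations
  Field IsDedekindDomain NumberField
  Literature.NumberTheory.EllipticCurves.Rank1Residual
  Summit.BirchSwinnertonDyer.Rank1Residual.Additive.MixedCongruence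

namespace Summit.BirchSwinnertonDyer.Rank1Residual.GaloisImage

variable {W : WeierstrassCurve ℚ} [W.IsElliptic] {p : ℕ} [Fact p.Prime]

/-! ## §0. Lines in the `𝔽_p`-plane `E[p]` (elementary; no Galois input) -/

omit [W.IsElliptic] [Fact p.Prime] in
/-- `E[p]` is `p`-torsion: `(p : ℤ) • P = 0`. [folklore] -/
theorem natCast_zsmul_eq_zero (P : geomTorsion W (p : ℤ)) : (p : ℤ) • P = 0 := by
  apply Subtype.ext
  have h : (p : ℤ) • (P : geomPoints W) = 0 := (Submodule.mem_torsionBy_iff (p : ℤ) _).mp P.2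
  rw [AddSubgroupClass.coe_zsmul, ZeroMemClass.coe_zero, h]

omit [W.IsElliptic] in
/-- An integer `c` invertible mod `p` acts invertibly on `E[p]`: `c • P ∈ L ⟹ P ∈ L` for every
subgroup `L`. [folklore] -/
theorem mem_of_zsmul_mem {c : ℤ} (hc : (c : ZMod p) ≠ 0) {L : AddSubgroup (geomTorsion W (p : ℤ))}
    {P : geomTorsion W (p : ℤ)} (h : c • P ∈ L) : P ∈ L := by
  obtain ⟨b, hb⟩ := ZMod.intCast_surjective ((c : ZMod p)⁻¹)
  have h1 : ((b * c - 1 : ℤ) : ZMod p) = 0 := by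
    rw [Int.cast_sub, Int.cast_mul, hb, Int.cast_one, inv_mul_cancel₀ hc, sub_self]
  obtain ⟨m, hm⟩ := (ZMod.intCast_zmod_eq_zero_iff_dvd _ p).mp h1
  have hP : P = b • (c • P) - m • ((p : ℤ) • P) := by
    rw [smul_smul, smul_smul, ← sub_smul, show b * c - m * p = 1 by linarith, one_smul]
  rw [hP, natCast_zsmul_eq_zero, smul_zero, sub_zero]
  exact L.zsmul_mem h b

omit [W.IsElliptic] in
/-- `c • P = 0 ⟹ P = 0` for `c` invertible mod `p`. [folklore] -/
theorem eq_zero_of_zsmul_eq_zero {c : ℤ} (hc : (c : ZMod p) ≠ 0) {P : geomTorsion W (p : ℤ)}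
    (h : c • P = 0) : P = 0 := by
  rw [← AddSubgroup.mem_bot]
  exact mem_of_zsmul_mem hc (L := ⊥) (by rw [h]; exact (⊥ : AddSubgroup _).zero_mem)

/-- A line is not all of `E[p]` (`#L = p < p² = #E[p]`): some point lies outside it. [folklore] -/
theorem exists_not_mem_of_natCard_eq {L : AddSubgroup (geomTorsion W (p : ℤ))}
    (hL : Nat.card L = p) : ∃ Q₀ : geomTorsion W (p : ℤ), Q₀ ∉ L := by
  have hp : p.Prime := Fact.out
  by_contra h
  push Not at h
  have htop : L = ⊤ := eq_top_iff.mpr fun P _ ↦ h P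
  have h1 : Nat.card L = p ^ 2 := by rw [htop, AddSubgroup.card_top, Literature.NumberTheory.EllipticCurves.natCard_geomTorsion W p]
  rw [hL, sq] at h1
  have h2 : p * 1 = p * p := by rw [mul_one]; exact h1
  exact hp.one_lt.ne (Nat.eq_of_mul_eq_mul_left hp.pos h2)

/-- A point outside a line generates a complementary line: every `P ∈ E[p]` is `y + n • Q₀` with
`y ∈ L`. [folklore] -/
theorem exists_mem_add_zsmul_of_not_mem {L : AddSubgroup (geomTorsion W (p : ℤ))}
    (hL : Nat.card L = p) {Q₀ : geomTorsion W (p : ℤ)} (hQ₀ : Q₀ ∉ L) (P : geomTorsion W (p : ℤ)) :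
    ∃ y ∈ L, ∃ n : ℤ, P = y + n • Q₀ := by
  have hQ₀0 : Q₀ ≠ 0 := fun h ↦ hQ₀ (h ▸ L.zero_mem)
  have hord : addOrderOf Q₀ = p :=
    addOrderOf_eq_prime (by rw [← natCast_zsmul]; exact natCast_zsmul_eq_zero Q₀) hQ₀0
  have hM : Nat.card (AddSubgroup.zmultiples Q₀) = p := by rw [Nat.card_zmultiples, hord]
  have hne : L ≠ AddSubgroup.zmultiples Q₀ := fun h ↦ hQ₀ (h ▸ AddSubgroup.mem_zmultiples Q₀)
  have htop := sup_eq_top_of_ne (Literature.NumberTheory.EllipticCurves.natCard_geomTorsion W p) hL hM hne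
  have hP : P ∈ L ⊔ AddSubgroup.zmultiples Q₀ := htop ▸ AddSubgroup.mem_top P
  obtain ⟨y, hy, z, hz, rfl⟩ := AddSubgroup.mem_sup.mp hP
  obtain ⟨n, rfl⟩ := AddSubgroup.mem_zmultiples_iff.mp hz
  exact ⟨y, hy, n, rfl⟩

/-- A subgroup of `E[p]` which is non-trivial and meets some line trivially is a line. [folklore] -/
theorem natCard_eq_of_ne_bot_of_inf_eq_bot {X L : AddSubgroup (geomTorsion W (p : ℤ))}
    (hX : X ≠ ⊥) (hL : Nat.card L = p) (hXL : X ⊓ L = ⊥) : Nat.card X = p := by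
  have hp : p.Prime := Fact.out
  have hE := Literature.NumberTheory.EllipticCurves.natCard_geomTorsion W p
  haveI : Finite (geomTorsion W (p : ℤ)) :=
    Nat.finite_of_card_ne_zero (by rw [hE]; exact pow_ne_zero 2 hp.ne_zero)
  have hdvd : Nat.card X ∣ p ^ 2 := hE ▸ X.card_addSubgroup_dvd_card
  obtain ⟨i, hi, hXi⟩ := (Nat.dvd_prime_pow hp).mp hdvd
  interval_cases i
  · exact absurd (AddSubgroup.card_eq_one.mp (by simpa using hXi)) hX
  · simpa using hXi
  · exfalso
    have htop : X = ⊤ := (AddSubgroup.card_eq_iff_eq_top X).mp (by rw [hXi, hE])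
    rw [htop, top_inf_eq] at hXL
    have h1 : Nat.card L = 1 := by rw [hXL]; exact AddSubgroup.card_bot
    exact hp.one_lt.ne' (hL.symm.trans h1)

omit [W.IsElliptic] [Fact p.Prime] in
/-- The `a`-eigenspace `{P | σ₀ • P = a • P}` of a Galois element on `E[p]` is a subgroup.
[folklore] -/
theorem exists_eigenAddSubgroup (σ₀ : absoluteGaloisGroup ℚ) (a : ℤ) :
    ∃ X : AddSubgroup (geomTorsion W (p : ℤ)), ∀ P, P ∈ X ↔ σ₀ • P = a • P :=
  ⟨{ carrier := {P | σ₀ • P = a • P}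
     zero_mem' := by simp
     add_mem' := by
       intro P Q hP hQ
       simp only [Set.mem_setOf_eq] at hP hQ ⊢
       rw [smul_add, hP, hQ, smul_add]
     neg_mem' := by
       intro P hP
       simp only [Set.mem_setOf_eq] at hP ⊢
       rw [smul_neg, hP, smul_neg] }, fun _ ↦ Iff.rfl⟩

omit [W.IsElliptic] in
/-- A Galois element stabilising a line `L ≤ E[p]` acts on it by an integer scalar (`L` is cyclic of
prime order). [folklore] -/
theorem exists_int_forall_mem_smul_eq_zsmul {L : AddSubgroup (geomTorsion W (p : ℤ))}
    (hL : Nat.card L = p) {τ : absoluteGaloisGroup ℚ} (hst : ∀ P ∈ L, τ • P ∈ L) :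
    ∃ c : ℤ, ∀ P ∈ L, τ • P = c • P := by
  have hp : p.Prime := Fact.out
  haveI : Fact (Nat.card L).Prime := ⟨by rw [hL]; exact hp⟩
  haveI : Finite L := Nat.finite_of_card_ne_zero (by rw [hL]; exact hp.ne_zero)
  haveI : IsAddCyclic L := isAddCyclic_of_prime_card hL
  obtain ⟨g, hg⟩ := IsAddCyclic.exists_zsmul_surjective (G := L)
  obtain ⟨c, hc⟩ := hg ⟨τ • (g : geomTorsion W (p : ℤ)), hst g g.2⟩
  have hc' : τ • (g : geomTorsion W (p : ℤ)) = c • (g : geomTorsion W (p : ℤ)) := by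
    have := congrArg Subtype.val hc
    simpa using this.symm
  refine ⟨c, fun P hP ↦ ?_⟩
  obtain ⟨n, hn⟩ := hg ⟨P, hP⟩
  have hn' : n • (g : geomTorsion W (p : ℤ)) = P := by
    have := congrArg Subtype.val hn
    simpa using this
  rw [← hn', smul_comm τ n (g : geomTorsion W (p : ℤ)), hc',
    smul_comm n c (g : geomTorsion W (p : ℤ))]

/-- A Galois element stabilising a line `L ≤ E[p]` acts on the quotient `E[p]/L` (cyclic of order
`p`) by an integer scalar: `τ • P − a • P ∈ L` for all `P`. [folklore] -/
theorem exists_int_forall_smul_sub_zsmul_mem {L : AddSubgroup (geomTorsion W (p : ℤ))}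
    (hL : Nat.card L = p) {τ : absoluteGaloisGroup ℚ} (hst : ∀ P ∈ L, τ • P ∈ L) :
    ∃ a : ℤ, ∀ P, τ • P - a • P ∈ L := by
  obtain ⟨Q₀, hQ₀⟩ := exists_not_mem_of_natCard_eq hL
  obtain ⟨y₀, hy₀, a, ha⟩ := exists_mem_add_zsmul_of_not_mem hL hQ₀ (τ • Q₀)
  refine ⟨a, fun P ↦ ?_⟩
  obtain ⟨y, hy, n, rfl⟩ := exists_mem_add_zsmul_of_not_mem hL hQ₀ P
  have h : τ • (y + n • Q₀) - a • (y + n • Q₀) = (τ • y - a • y) + n • y₀ := by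
    rw [smul_add, smul_comm τ n Q₀, ha]
    generalize τ • y = t
    module
  rw [h]
  exact L.add_mem (L.sub_mem (hst y hy) (L.zsmul_mem hy a)) (L.zsmul_mem hy₀ n)

/-! ## §1. No unipotent element in a small image (Serre Prop. 15 backwards) -/

variable (W p) in
/-- **No unipotent Galois element at an irreducible, non-surjective prime.** If `E[p]` is irreducible
and `ρ̄_{E,p}` is not onto, every `τ ∈ Γ_ℚ` acting unipotently on `E[p]`
(`τ • (τ • Q − Q) = τ • Q − Q` for all `Q`) acts trivially: otherwise `ρ̄(τ)` has order `p`
(`galoisRepTorsion_pow_prime_eq_one_of_unipotent`) while a proper irreducible subgroup of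
`GL₂(𝔽_p)` with full determinant has order prime to `p` (Serre 1972 Prop. 15;
`not_dvd_card_of_not_hasSurjectiveModNGaloisRep`). [cite: Serre1972, §2.4 Prop. 15] -/
theorem smul_eq_self_of_unipotent_of_irr_of_not_surj (hirr : Irr W p) (hns : ¬ Surj W p)
    {τ : absoluteGaloisGroup ℚ}
    (h : ∀ Q : geomTorsion W (p : ℤ), τ • (τ • Q - Q) = τ • Q - Q)
    (Q : geomTorsion W (p : ℤ)) : τ • Q = Q := by
  have hp : p.Prime := Fact.out
  by_contra hQ
  obtain ⟨e, Φ, he, -⟩ := exists_frame_galoisRepTorsion_rat W p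
  have hG : ¬ p ∣ Nat.card (galoisRepTorsion W p).range := by
    rw [← card_map_range_galoisRepTorsion W p Φ]
    exact not_dvd_card_of_not_hasSurjectiveModNGaloisRep W p Φ e he hirr hns
  have hpow : galoisRepTorsion W p τ ^ p = 1 :=
    galoisRepTorsion_pow_prime_eq_one_of_unipotent W p h
  have hne : galoisRepTorsion W p τ ≠ 1 := fun h1 ↦
    hQ ((galoisRepTorsion_eq_one_iff' W (p : ℤ) τ).mp h1 Q)
  have hord : orderOf (galoisRepTorsion W p τ) = p := by
    rcases (Nat.dvd_prime hp).mp (orderOf_dvd_of_pow_eq_one hpow) with h1 | h1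
    · exact absurd (orderOf_eq_one_iff.mp h1) hne
    · exact h1
  have h2 : orderOf (galoisRepTorsion W p τ) ∣ Nat.card (galoisRepTorsion W p).range :=
    Subgroup.orderOf_dvd_natCard _ ⟨τ, rfl⟩
  rw [hord] at h2
  exact hG h2

variable (W p) in
/-- **Line-stabiliser form.** Under `Irr W p ∧ ¬ Surj W p`: a Galois element fixing a line
`L ≤ E[p]` pointwise and acting trivially on `E[p]/L` acts trivially on `E[p]`.
[cite: Serre1972, §2.4 Prop. 15] -/
theorem smul_eq_self_of_fix_line_of_irr_of_not_surj (hirr : Irr W p) (hns : ¬ Surj W p)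
    {L : AddSubgroup (geomTorsion W (p : ℤ))} {τ : absoluteGaloisGroup ℚ}
    (hfix : ∀ P ∈ L, τ • P = P) (hquot : ∀ P, τ • P - P ∈ L) (Q : geomTorsion W (p : ℤ)) :
    τ • Q = Q :=
  smul_eq_self_of_unipotent_of_irr_of_not_surj W p hirr hns (fun P ↦ hfix _ (hquot P)) Q

/-! ## §2. The image of a line-stabilising subgroup is abelian -/

variable (W p) in
/-- **Commutativity.** Under `Irr W p ∧ ¬ Surj W p`, let `I ≤ Γ_ℚ` stabilise a line `L ≤ E[p]`.
Then any two elements of `I` commute on `E[p]`: both act by scalars on the cyclic groups `L` and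
`E[p]/L`, so the commutator fixes `L` pointwise and acts trivially on `E[p]/L`, hence is trivial by
`smul_eq_self_of_fix_line_of_irr_of_not_surj` (the image of `I` meets the unipotent radical of the
Borel subgroup of `L` trivially, so it embeds in the torus). [cite: Serre1972, §2.4 Prop. 15] -/
theorem smul_comm_of_stableLine_of_irr_of_not_surj (hirr : Irr W p) (hns : ¬ Surj W p)
    {I : Subgroup (absoluteGaloisGroup ℚ)} {L : AddSubgroup (geomTorsion W (p : ℤ))}
    (hL : Nat.card L = p) (hst : ∀ σ ∈ I, ∀ P ∈ L, σ • P ∈ L)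
    {τ τ' : absoluteGaloisGroup ℚ} (hτ : τ ∈ I) (hτ' : τ' ∈ I) (P : geomTorsion W (p : ℤ)) :
    τ • τ' • P = τ' • τ • P := by
  -- scalars on `L` and on `E[p]/L`
  obtain ⟨c, hc⟩ := exists_int_forall_mem_smul_eq_zsmul hL (hst τ hτ)
  obtain ⟨c', hc'⟩ := exists_int_forall_mem_smul_eq_zsmul hL (hst τ' hτ')
  obtain ⟨a, ha⟩ := exists_int_forall_smul_sub_zsmul_mem hL (hst τ hτ)
  obtain ⟨a', ha'⟩ := exists_int_forall_smul_sub_zsmul_mem hL (hst τ' hτ')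
  -- (1) `τ, τ'` commute on `L`
  have hcommL : ∀ x ∈ L, τ • τ' • x = τ' • τ • x := by
    intro x hx
    rw [hc' x hx, smul_comm τ c' x, hc x hx, hc' _ (L.zsmul_mem hx c), smul_comm c' c x]
  -- (2) `τ τ' R − τ' τ R ∈ L` for every `R`
  have hcommQ : ∀ R, τ • τ' • R - τ' • τ • R ∈ L := by
    intro R
    obtain ⟨y, hy⟩ : ∃ y, y = τ • R - a • R := ⟨_, rfl⟩
    obtain ⟨y', hy'⟩ : ∃ y', y' = τ' • R - a' • R := ⟨_, rfl⟩
    have hyL : y ∈ L := hy ▸ ha R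
    have hy'L : y' ∈ L := hy' ▸ ha' R
    have e1 : τ • R = y + a • R := by rw [hy, sub_add_cancel]
    have e2 : τ' • R = y' + a' • R := by rw [hy', sub_add_cancel]
    have h : τ • τ' • R - τ' • τ • R = (τ • y' - a • y') - (τ' • y - a' • y) := by
      rw [e2, e1, smul_add, smul_add, smul_comm τ a' R, smul_comm τ' a R, e1, e2]
      generalize τ • y' = t₁
      generalize τ' • y = t₂
      module
    rw [h]
    exact L.sub_mem (L.sub_mem (hst τ hτ y' hy'L) (L.zsmul_mem hy'L a))
      (L.sub_mem (hst τ' hτ' y hyL) (L.zsmul_mem hyL a'))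
  -- (3) the commutator `κ = τ τ' τ⁻¹ τ'⁻¹` is unipotent, hence trivial
  obtain ⟨κ, hκ⟩ : ∃ κ : absoluteGaloisGroup ℚ, κ = τ * τ' * τ⁻¹ * τ'⁻¹ := ⟨_, rfl⟩
  have hκact : ∀ R : geomTorsion W (p : ℤ), κ • R = τ • τ' • τ⁻¹ • τ'⁻¹ • R := fun R ↦ by
    rw [hκ, mul_smul, mul_smul, mul_smul]
  have hinvL : ∀ {σ : absoluteGaloisGroup ℚ}, σ ∈ I → ∀ x ∈ L, σ⁻¹ • x ∈ L :=
    fun hσ x hx ↦ hst _ (I.inv_mem hσ) x hx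
  have hκfix : ∀ x ∈ L, κ • x = x := by
    intro x hx
    rw [hκact, hcommL _ (hinvL hτ _ (hinvL hτ' x hx)), smul_inv_smul, smul_inv_smul]
  have hκquot : ∀ R, κ • R - R ∈ L := by
    intro R
    have h := hcommQ (τ⁻¹ • τ'⁻¹ • R)
    have e1 : τ • τ' • τ⁻¹ • τ'⁻¹ • R = κ • R := (hκact R).symm
    have e2 : τ' • τ • τ⁻¹ • τ'⁻¹ • R = R := by rw [smul_inv_smul, smul_inv_smul]
    rwa [e1, e2] at h
  have hκtriv := smul_eq_self_of_fix_line_of_irr_of_not_surj W p hirr hns hκfix hκquot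
  -- unwind: `κ (τ' τ P) = τ τ' P`
  have h := hκtriv (τ' • τ • P)
  rw [hκact, inv_smul_smul, inv_smul_smul] at h
  exact h

end Summit.BirchSwinnertonDyer.Rank1Residual.GaloisImage

end
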